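import Summits.BirchSwinnertonDyer.BirchSwinnertonDyer.Theses.UniversalToricDescent
import Summits.BirchSwinnertonDyer.BirchSwinnertonDyer.Theorems.EisensteinPrimesHidaLimitFittingBoundConverse
import HarnessLib

/-!
# NODE (D-0171) — g26 · `RationalSplitIMCInclusionAtThree` (stmt-BirchSwinnertonDyer-24207)
# Squarefree-cofactor parity: on (ELL)+(SQ-root) rows the rational wall ABSORBS any cofactor that is squarefree away from 3

Seat `cruxidea-stmt-BirchSwinnertonDyer-24207-1` gen 26 (planner, crux-ideate standing cover), 2026-08-31.
Route `route-BirchSwinnertonDyer-UniversalToricDescent`; crux decl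
`Summit.BirchSwinnertonDyer.BirchSwinnertonDyer.Theses.UniversalToricDescent.RationalSplitIMCInclusionAtThree`
(RATWALL: `∃ k, 3ᵏ·L ∈ Ch_Λ(X_(∅,0))·R₀⟦T⟧`).  Kind: IMPLIED-BY through one format piece (SQC) that is IMPLIED BY the
crux on every row (`squarefreeCofactorInclusion_of_crux`) and gives it back on (SQ)+(AN) rows through the parity
support (PAR) (`rationalSplitIMCInclusionAtThree_of_squarefreeCofactorParity`, concludes the crux BY NAME, 0 sorry).
«beyond-print theorem»: no.  BSD is proved for no curve by this file.

## Pieces and tags (COSTUME / WEAKER / UNDECIDED; leaves ATTACKABLE / INSTRUMENTABLE / IDEA-NEEDED / BARRIER)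

* (SQ)  `SquareCharGeneratorAtThree` — g14/g24/g25 VERBATIM: `Ch·R₀⟦T⟧ = (F₁²)`. [WEAKER (⟸ g24 (ELL), Howard's twisted
        self-duality of the relaxed/strict structure) · leaf ATTACKABLE (g24 S1–S3)].
* (AN)  `SquareRootLFunctionAtThree` — g24/g25 VERBATIM: `L = u·3ᵇ·L₁²`. [WEAKER (true for the BDP square `L = 𝓛_𝔭²`,
        `𝓛_𝔭 ∈ W(𝔽̄₃)⟦T⟧`) · leaf ATTACKABLE].
* (PAR) `ParityAbsorptionAtThree` — NEW SUPPORT: in `R₀⟦T⟧ = W(𝔽̄₃)⟦T⟧`, `h` squarefree away from 3 and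
        `G² ∣ 3ᵏ·M²·h` ⟹ `∃ k', G² ∣ 3ᵏ'·M²`. [WEAKER — TRUE (valuation parity in the UFD `W(𝔽̄₃)⟦T⟧`: for every
        height-one prime `π ≠ (3)`, `2v_π(G) ≤ 2v_π(M) + v_π(h) ≤ 2v_π(M) + 1` forces `v_π(G) ≤ v_π(M)`) · leaf
        ATTACKABLE (M): Mathlib has Weierstrass preparation for `PowerSeries` over a complete local ring but no
        `UniqueFactorizationMonoid (PowerSeries R₀)`; route: `3^μ·P·unit` normal form + `Polynomial.uniqueFactorizationMonoid`
        over the DVR `R₀` (tree `unrIntegers` DVR API).  FALSE in non-UFD domains (ℤ[√−5]: `2² ∣ (1+√−5)²·2`, `2` squarefree,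
        `2 ∤ 1+√−5`), so the piece is genuinely about `R₀⟦T⟧`.]
* (SQC) `SquarefreeCofactorInclusionAtThree` — NEW FORMAT: `∃ k h, h squarefree away from 3 ∧ 3ᵏ·L·h ∈ Ch·R₀⟦T⟧`.
        [WEAKER as a bare statement (witness over ℤ with `c = 3`: `F = 35, L = 5, h = 7` — `F ∣ L·h`, `F ∤ 3ᵏ·L`; kernel
        `examples` §D) · IMPLIED BY the crux on every row (`h = 1`) · EQUIVALENT to the crux on (SQ)+(AN) rows given (PAR)
        (this door) · leaf IDEA-NEEDED / BARRIER: no engine on the supercuspidal rows produces even this format today —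
        `TraceZeroHeegnerTowerAtAdditiveSplitP` (B1) and `NoAdmissiblePrimesAtThree` bite every CM-class supply; the format
        is what an argument with MULTIPLICITY-ONE error terms would deliver: (i) a Kolyvagin/Euler-system bound whose
        error is supported on finitely many height-one primes each to exponent ≤ 1 (Mazur–Rubin 2004 Thm 5.3.10-shape with
        controlled exceptional set); (ii) a Poitou–Tate comparison whose local defect module is semisimple-cyclic at each
        root; (iii) a tooth/comb argument (LEAD `Lines/ratwall_thin_comb`) that certifies `ord_α L ≥ ord_α F − 1` at the
        finitely many roots it cannot reach exactly; (iv) in the Fréchet ring `𝓗_{R₀}` (prose only): `F ∣ L·ℓ` with `ℓ` having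
        SIMPLE zeros (Perrin-Riou Γ-factors, `log(1+T)/T = ∏ Φ_{3ˢ}(1+T)/3`) — parity is root-wise, so the same absorption holds.]

## KEEP/KILL (g26) — the g25 table STANDS (no `Disproof.lean`, no `TRIAGE-*`, no `Negative/`, no COVER CLOSED on the bus; LEAD skeleton
`Lines/ratwall_thin_comb.lean` sha 59ba7de5… unchanged, stubs `stub_printInputs` / `stub_toricFrameExistsOfBDP` / `stub_ratCombDvdUpTo2`).
Negatives index re-read 2026-08-31: {stmt-15532 `LeadingTermTamePinch_refuted`, stmt-24881 `not_EquivariantChebotarevAtTwo`} — disjoint.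

## Three g26 candidates KILLED BEFORE FILING (independent re-derivations that REDUCE to cards on file — recorded as convergence evidence)
(α) «ϑ-descent of the nebentype half-twist» (Howard 2007 §2 fixed-weight descent of Heegner points of `g = f_E ⊗ ε⁻¹` on the PS rows,
    order-½ carrier + near-root rational KS) = desk card `half-twist-heegner-tower` (utd-idea g31, crux 20395) ∘ door
    `layer-cake-sublinear-slack` (g12); standing rule B-g14-4 / B-g16-2 (nebentypus unwinding is the desk's, not this lineage's).
(β) «real-quadratic inducing-field host» (`K‴ = ℚ(√(3|d_K|))` or any `F` with `F_𝔮 ⊇ F₃` for all `𝔮 ∣ 3`): taming a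
    supercuspidal type to PS needs EVEN local degree at every `𝔮 ∣ 3`, hence `[F:ℚ]` even, hence `ε(E/FK) = (−1)^{[F:ℚ]} = +1`
    (all finite places split or PS): DEFINITE, `θ ≡ 0` on `K`'s line (B-g11-1/B-g14-3, now uniform for SCu AND SCr); the
    transverse weight-derivative is g8's move; bipartite level-raising stays dead (`q² ≡ 1 (mod 3)` for every prime `q > 3` of
    every number field: `NoAdmissiblePrimesAtThree` is host-independent).
(γ) «Serre–Tate / Heegner-disc reading» (`f^♭ = f` ⟹ `d⁻¹f = c_φ⁻¹·log_E∘φ` on the ordinary CM discs with NO Frobenius correction;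
    disc zeros = `φ⁻¹(E_tors) ∩ D(𝔞∗A₀)` with multiplicity `1 + ord ω_f`) = g15 `psi-zero-honda-frame` (iii) verbatim, and the
    torsion-preimage root description is g24's examined candidate (Q) «Serre–Tate torsion preimage (FALSE)» (the branch
    function is a character-twisted SUM over `Pic(𝒪_K) × μ₂`, not one disc primitive).

## Barrier notes (for `Literature/Barriers/BirchSwinnertonDyer/`)
* PARITY LOCK OF TYPE-TAMING HOSTS (sharpens B-g11-1): for `π₃` supercuspidal (SCu: unramified induction, SCr: ramified), every
  totally real `F` over which `BC_F(π)_𝔮` is principal series at ALL `𝔮 ∣ 3` has all local degrees `[F_𝔮:ℚ₃]` even, so `[F:ℚ]`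
  is even and `(BC_F π, FK)` is definite for every imaginary quadratic `K` with the Heegner hypothesis (no finite place can
  flip the sign: primes of `N'` split in `K`, primes over 3 split in `FK/F`).  Kills every «tame the type, keep Heegner» host.
* `NoAdmissiblePrimesAtThree` is HOST-INDEPENDENT: `3 ∣ q² − 1` for every rational prime `q > 3`, hence for the residue
  characteristic of every prime of every number field away from `{2,3}`; bipartite Euler systems at `p = 3` do not exist over
  any base.  Kolyvagin primes (`ℓ ≡ −1 (3ᵐ)`, `a_ℓ ≡ 0`) do exist and satisfy Ribet's level-raising congruence trivially, but
  the level-raised definite theta elements in the `3`-tower of a supercuspidal `π₃` have trace zero as well (same `J(π₃)=0`).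
-/

set_option autoImplicit false
set_option linter.dupNamespace false

noncomputable section

open scoped Classical

namespace Summit.BirchSwinnertonDyer.BirchSwinnertonDyer.Cruxes.RationalSplitIMCInclusionAtThree.SquarefreeCofactorParity

/-! ## §A  Pure commutative algebra: squarefree-up-to-`c` cofactors and the parity absorption step -/

/-- `h` is SQUAREFREE AWAY FROM `c`: every square divisor of `h` divides a power of `c`
(in `R₀⟦T⟧` with `c = 3`: the distinguished polynomial of `h` is separable; `3`-powers and units are free). -/
def IsSquarefreeUpTo {S : Type*} [CommRing S] (c h : S) : Prop :=
  ∀ x : S, x * x ∣ h → ∃ a : ℕ, x ∣ c ^ a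

theorem isSquarefreeUpTo_one {S : Type*} [CommRing S] (c : S) : IsSquarefreeUpTo c 1 := by
  intro x hx
  exact ⟨0, by rw [pow_zero]; exact (dvd_mul_right x x).trans hx⟩

theorem IsSquarefreeUpTo.of_unit_mul {S : Type*} [CommRing S] {c h u : S} (hu : IsUnit u)
    (hh : IsSquarefreeUpTo c h) : IsSquarefreeUpTo c (u * h) := by
  intro x hx
  obtain ⟨v, hv⟩ := hu.exists_left_inv
  apply hh x
  have heq : h = v * (u * h) := by rw [← mul_assoc, hv, one_mul]
  rw [heq]
  exact dvd_mul_of_dvd_right hx v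

/-- **Parity absorption ⟹ membership (any commutative ring, given the parity property as a hypothesis).**
`L = u·cᵇ·L₁²` (`u` a unit), `h` squarefree away from `c`, `cᵏ·L·h ∈ (F₁²)` and the parity property of the ring
⟹ `cᵏ'·L ∈ (F₁²)`. -/
theorem mem_span_sq_of_parity {S : Type*} [CommRing S] {c F₁ L L₁ u h : S} {b k : ℕ}
    (hpar : ∀ (G M h : S) (k : ℕ), IsSquarefreeUpTo c h → G ^ 2 ∣ c ^ k * M ^ 2 * h →
      ∃ k' : ℕ, G ^ 2 ∣ c ^ k' * M ^ 2)
    (hu : IsUnit u) (hL : L = u * c ^ b * L₁ ^ 2) (hh : IsSquarefreeUpTo c h)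
    (hmem : c ^ k * L * h ∈ Ideal.span {F₁ ^ 2}) :
    ∃ k' : ℕ, c ^ k' * L ∈ Ideal.span {F₁ ^ 2} := by
  rw [Ideal.mem_span_singleton] at hmem
  have hdvd : F₁ ^ 2 ∣ c ^ (k + b) * L₁ ^ 2 * (u * h) := by
    have heq : c ^ (k + b) * L₁ ^ 2 * (u * h) = c ^ k * L * h := by rw [hL]; ring
    rw [heq]; exact hmem
  obtain ⟨k', hk'⟩ := hpar F₁ L₁ (u * h) (k + b) (hh.of_unit_mul hu) hdvd
  refine ⟨k', ?_⟩
  rw [Ideal.mem_span_singleton]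
  have heq2 : c ^ k' * L = (c ^ k' * L₁ ^ 2) * (u * c ^ b) := by rw [hL]; ring
  rw [heq2]
  exact dvd_mul_of_dvd_left hk' _

/-! ## §B  The pieces, under 24207's binders (verbatim prefix of the crux; (SQ)/(AN) carry `X_(∅,0)` `Λ`-torsion as in g14/g24/g25) -/

/-- `IsSquarefreeUpToThree h := IsSquarefreeUpTo 3 h` in `R₀⟦T⟧`. -/
def IsSquarefreeUpToThree (h : Literature.NumberTheory.EllipticCurves.UnrSeries 3) : Prop :=
  IsSquarefreeUpTo ((3 : ℕ) : Literature.NumberTheory.EllipticCurves.UnrSeries 3) h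

/-- **(SQ) — g14/g24/g25's `SquareCharGeneratorAtThree` VERBATIM [WEAKER (⟸ g24 (ELL)) · leaf ATTACKABLE]** `Ch_Λ(X_(∅,0))·R₀⟦T⟧ = (F₁²)`. -/
def SquareCharGeneratorAtThree : Prop :=
  ∀ (W : WeierstrassCurve ℚ) [W.IsElliptic] [W.IsGloballyMinimal] (N : ℕ) [NeZero N] (K : Type) [Field K] [NumberField K] (Dt : Literature.NumberTheory.EllipticCurves.ModularForms.ModularParametrizationData W N), Summit.BirchSwinnertonDyer.Rank1Residual.Additive.ClassO6 W 3 → W.HasSurjectiveModNGaloisRep 3 → W.analyticRank = 1 → W.conductorNorm ℤ = N → Literature.NumberTheory.EllipticCurves.IsImaginaryQuadratic K → Literature.NumberTheory.EllipticCurves.SatisfiesHeegnerHypothesis N K → ∀ (κ : Literature.NumberTheory.EllipticCurves.ZpExtension K 3), κ.IsAnticyclotomic → ∀ (γ : Field.absoluteGaloisGroup K) [Fact (κ.IsTopGenerator γ)] (𝔭 : IsDedekindDomain.HeightOneSpectrum (NumberField.RingOfIntegers K)), ((3 : ℕ) : NumberField.RingOfIntegers K) ∈ 𝔭.asIdeal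 → 𝔭.asIdeal.ramificationIdx (NumberField.RingOfIntegers ℚ) = 1 → 𝔭.asIdeal.inertiaDeg (NumberField.RingOfIntegers ℚ) = 1 → ∀ (𝔭' : IsDedekindDomain.HeightOneSpectrum (NumberField.RingOfIntegers K)), ((3 : ℕ) : NumberField.RingOfIntegers K) ∈ 𝔭'.asIdeal → 𝔭' ≠ 𝔭 → ∀ (ι' : PadicAlgCl 3 ≃+* ℂ), Summit.BirchSwinnertonDyer.BirchSwinnertonDyer.Theorems.SchneiderFree.BranchInducesPrime 3 ι' 𝔭 → ∀ (ΩK : ℂ) (Ωp : ℂ_[3]) (L : Literature.NumberTheory.EllipticCurves.UnrSeries 3), ΩK ≠ 0 → Ωp ≠ 0 → Literature.NumberTheory.EllipticCurves.IsBDPLFunction ι' 𝔭 κ γ Dt.f ΩK Ωp L → Module.IsTorsion (Literature.NumberTheory.EllipticCurves.IwasawaAlgebra 3) (Summit.BirchSwinnertonDyer.Rank1Residual.X11b.AcSelmer.XAc (W.baseChange K) 3 κ 𝔭' ∅ γ) →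
    ∃ F₁ : Literature.NumberTheory.EllipticCurves.UnrSeries 3,
      (Summit.BirchSwinnertonDyer.Rank1Residual.X11b.AcSelmer.XAc.charIdeal (W.baseChange K) 3 κ 𝔭' ∅ γ).map (PowerSeries.map (Summit.BirchSwinnertonDyer.Rank1Residual.X11b.Halves.toUnr 3)) = Ideal.span {F₁ ^ 2}

/-- **(AN) — g24/g25's `SquareRootLFunctionAtThree` VERBATIM [WEAKER — true for the BDP square · leaf ATTACKABLE]** `L = u·3^b·L₁²`. -/
def SquareRootLFunctionAtThree : Prop :=
  ∀ (W : WeierstrassCurve ℚ) [W.IsElliptic] [W.IsGloballyMinimal] (N : ℕ) [NeZero N] (K : Type) [Field K] [NumberField K] (Dt : Literature.NumberTheory.EllipticCurves.ModularForms.ModularParametrizationData W N), Summit.BirchSwinnertonDyer.Rank1Residual.Additive.ClassO6 W 3 → W.HasSurjectiveModNGaloisRep 3 → W.analyticRank = 1 → W.conductorNorm ℤ = N → Literature.NumberTheory.EllipticCurves.IsImaginaryQuadratic K → Literature.NumberTheory.EllipticCurves.SatisfiesHeegnerHypothesis N K → ∀ (κ : Literature.NumberTheory.EllipticCurves.ZpExtension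 K 3), κ.IsAnticyclotomic → ∀ (γ : Field.absoluteGaloisGroup K) [Fact (κ.IsTopGenerator γ)] (𝔭 : IsDedekindDomain.HeightOneSpectrum (NumberField.RingOfIntegers K)), ((3 : ℕ) : NumberField.RingOfIntegers K) ∈ 𝔭.asIdeal → 𝔭.asIdeal.ramificationIdx (NumberField.RingOfIntegers ℚ) = 1 → 𝔭.asIdeal.inertiaDeg (NumberField.RingOfIntegers ℚ) = 1 → ∀ (𝔭' : IsDedekindDomain.HeightOneSpectrum (NumberField.RingOfIntegers K)), ((3 : ℕ) : NumberField.RingOfIntegers K) ∈ 𝔭'.asIdeal → 𝔭' ≠ 𝔭 → ∀ (ι' : PadicAlgCl 3 ≃+* ℂ), Summit.BirchSwinnertonDyer.BirchSwinnertonDyer.Theorems.SchneiderFree.BranchInducesPrime 3 ι' 𝔭 → ∀ (ΩK : ℂ) (Ωp : ℂ_[3]) (L : Literature.NumberTheory.EllipticCurves.UnrSeries 3), ΩK ≠ 0 → Ωp ≠ 0 → Literature.NumberTheory.EllipticCurves.IsBDPLFunction ι' 𝔭 κ γ Dt.f ΩK Ωp L → Module.IsTorsion (Literature.NumberTheory.EllipticCurves.IwasawaAlgebra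 3) (Summit.BirchSwinnertonDyer.Rank1Residual.X11b.AcSelmer.XAc (W.baseChange K) 3 κ 𝔭' ∅ γ) →
    ∃ (L₁ u : Literature.NumberTheory.EllipticCurves.UnrSeries 3) (b : ℕ), IsUnit u ∧
      L = u * ((3 : ℕ) : Literature.NumberTheory.EllipticCurves.UnrSeries 3) ^ b * L₁ ^ 2

/-- **(PAR) [NEW support · WEAKER — TRUE in the UFD `R₀⟦T⟧` (valuation parity) · leaf ATTACKABLE (M): Weierstrass preparation
(Mathlib `PowerSeries` over the complete DVR `R₀`) + unique factorisation of distinguished polynomials over `R₀`]**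
PARITY ABSORPTION: `h` squarefree away from 3 and `G² ∣ 3ᵏ·M²·h` ⟹ `G² ∣ 3ᵏ'·M²`. -/
def ParityAbsorptionAtThree : Prop :=
  ∀ (G M h : Literature.NumberTheory.EllipticCurves.UnrSeries 3) (k : ℕ), IsSquarefreeUpToThree h →
    G ^ 2 ∣ ((3 : ℕ) : Literature.NumberTheory.EllipticCurves.UnrSeries 3) ^ k * M ^ 2 * h →
    ∃ k' : ℕ, G ^ 2 ∣ ((3 : ℕ) : Literature.NumberTheory.EllipticCurves.UnrSeries 3) ^ k' * M ^ 2

/-- **(SQC) [NEW format · WEAKER as a bare statement · IMPLIED BY the crux (`h = 1`) · EQUIVALENT to it on (SQ)+(AN) rows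
via (PAR) · leaf IDEA-NEEDED / BARRIER (B1 TraceZero, NoAdmissiblePrimesAtThree: no supercuspidal supply yet)]**
SQUAREFREE-COFACTOR INCLUSION: the BDP function times SOME cofactor squarefree away from 3 lies, up to a power of 3, in
the extended characteristic ideal of `X_(∅,0)`. -/
def SquarefreeCofactorInclusionAtThree : Prop :=
  ∀ (W : WeierstrassCurve ℚ) [W.IsElliptic] [W.IsGloballyMinimal] (N : ℕ) [NeZero N] (K : Type) [Field K] [NumberField K] (Dt : Literature.NumberTheory.EllipticCurves.ModularForms.ModularParametrizationData W N), Summit.BirchSwinnertonDyer.Rank1Residual.Additive.ClassO6 W 3 → W.HasSurjectiveModNGaloisRep 3 → W.analyticRank = 1 → W.conductorNorm ℤ = N → Literature.NumberTheory.EllipticCurves.IsImaginaryQuadratic K → Literature.NumberTheory.EllipticCurves.SatisfiesHeegnerHypothesis N K → ∀ (κ : Literature.NumberTheory.EllipticCurves.ZpExtension K 3), κ.IsAnticyclotomic → ∀ (γ : Field.absoluteGaloisGroup K) [Fact (κ.IsTopGenerator γ)] (𝔭 : IsDedekindDomain.HeightOneSpectrum (NumberField.RingOfIntegers K)), ((3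 : ℕ) : NumberField.RingOfIntegers K) ∈ 𝔭.asIdeal → 𝔭.asIdeal.ramificationIdx (NumberField.RingOfIntegers ℚ) = 1 → 𝔭.asIdeal.inertiaDeg (NumberField.RingOfIntegers ℚ) = 1 → ∀ (𝔭' : IsDedekindDomain.HeightOneSpectrum (NumberField.RingOfIntegers K)), ((3 : ℕ) : NumberField.RingOfIntegers K) ∈ 𝔭'.asIdeal → 𝔭' ≠ 𝔭 → ∀ (ι' : PadicAlgCl 3 ≃+* ℂ), Summit.BirchSwinnertonDyer.BirchSwinnertonDyer.Theorems.SchneiderFree.BranchInducesPrime 3 ι' 𝔭 → ∀ (ΩK : ℂ) (Ωp : ℂ_[3]) (L : Literature.NumberTheory.EllipticCurves.UnrSeries 3), ΩK ≠ 0 → Ωp ≠ 0 → Literature.NumberTheory.EllipticCurves.IsBDPLFunction ι' 𝔭 κ γ Dt.f ΩK Ωp L →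
    ∃ (k : ℕ) (h : Literature.NumberTheory.EllipticCurves.UnrSeries 3), IsSquarefreeUpToThree h ∧
      ((3 : ℕ) : Literature.NumberTheory.EllipticCurves.UnrSeries 3) ^ k * L * h ∈
        (Summit.BirchSwinnertonDyer.Rank1Residual.X11b.AcSelmer.XAc.charIdeal (W.baseChange K) 3 κ 𝔭' ∅ γ).map (PowerSeries.map (Summit.BirchSwinnertonDyer.Rank1Residual.X11b.Halves.toUnr 3))

/-! ## §C  Kernels -/

/-- **WEAKER-certificate: the crux ⟹ (SQC)** on every row, with the trivial cofactor `h = 1`.  So (SQC) is a waypoint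
implied by 24207, never a costume. -/
theorem squarefreeCofactorInclusion_of_crux
    (hc : Summit.BirchSwinnertonDyer.BirchSwinnertonDyer.Theses.UniversalToricDescent.RationalSplitIMCInclusionAtThree) :
    SquarefreeCofactorInclusionAtThree := by
  intro W _ _ N _ K _ _ Dt hO6 hsurj hr1 hN hK hH κ hκ γ _ 𝔭 h𝔭 he hf 𝔭' h𝔭' hne ι' hι ΩK Ωp L hΩK hΩp hL
  obtain ⟨k, hk⟩ := hc W N K Dt hO6 hsurj hr1 hN hK hH κ hκ γ 𝔭 h𝔭 he hf 𝔭' h𝔭' hne ι' hι ΩK Ωp L hΩK hΩp hL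
  refine ⟨k, 1, isSquarefreeUpTo_one _, ?_⟩
  rw [mul_one]
  exact hk

/-- **DOOR (kernel-checked, concludes the crux BY NAME).** (SQ) ∧ (AN) ∧ (PAR) ∧ (SQC) ⟹ 24207: on a torsion row, the square
generator `F₁²` (SQ), the analytic square root (AN) and the cofactor membership (SQC) give `F₁² ∣ 3^(k+b)·L₁²·(u h)` with `u h`
squarefree away from 3; parity absorption (PAR) removes the cofactor; on a non-torsion row `Ch = Λ` and `k = 0`. -/
theorem rationalSplitIMCInclusionAtThree_of_squarefreeCofactorParity
    (hSQ : SquareCharGeneratorAtThree) (hAN : SquareRootLFunctionAtThree)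
    (hPAR : ParityAbsorptionAtThree) (hSQC : SquarefreeCofactorInclusionAtThree) :
    Summit.BirchSwinnertonDyer.BirchSwinnertonDyer.Theses.UniversalToricDescent.RationalSplitIMCInclusionAtThree := by
  intro W _ _ N _ K _ _ Dt hO6 hsurj hr1 hN hK hH κ hκ γ _ 𝔭 h𝔭 he hf 𝔭' h𝔭' hne ι' hι ΩK Ωp L hΩK hΩp hL
  by_cases htor : Module.IsTorsion (Literature.NumberTheory.EllipticCurves.IwasawaAlgebra 3) (Summit.BirchSwinnertonDyer.Rank1Residual.X11b.AcSelmer.XAc (W.baseChange K) 3 κ 𝔭' ∅ γ)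
  · obtain ⟨F₁, hCh⟩ := hSQ W N K Dt hO6 hsurj hr1 hN hK hH κ hκ γ 𝔭 h𝔭 he hf 𝔭' h𝔭' hne ι' hι ΩK Ωp L hΩK hΩp hL htor
    obtain ⟨L₁, u, b, hu, hLeq⟩ := hAN W N K Dt hO6 hsurj hr1 hN hK hH κ hκ γ 𝔭 h𝔭 he hf 𝔭' h𝔭' hne ι' hι ΩK Ωp L hΩK hΩp hL htor
    obtain ⟨k, h, hh, hmem⟩ := hSQC W N K Dt hO6 hsurj hr1 hN hK hH κ hκ γ 𝔭 h𝔭 he hf 𝔭' h𝔭' hne ι' hι ΩK Ωp L hΩK hΩp hL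
    rw [hCh] at hmem ⊢
    exact mem_span_sq_of_parity (fun G M h' k' hh' hd => hPAR G M h' k' hh' hd) hu hLeq hh hmem
  · refine ⟨0, ?_⟩
    have htop : Summit.BirchSwinnertonDyer.Rank1Residual.X11b.AcSelmer.XAc.charIdeal (W.baseChange K) 3 κ 𝔭' ∅ γ = ⊤ :=
      Summit.BirchSwinnertonDyer.BirchSwinnertonDyer.Theorems.charIdeal_eq_top_of_not_isTorsion (p := 3) _ htor
    rw [htop, Ideal.map_top]; exact Submodule.mem_top

/-! ## §D  WEAKER-certificates for the bare format (toy ring `ℤ`, `c = 3`): `F = 35 ∣ L·h = 5·7` with `h = 7` squarefree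
away from 3, yet `F ∤ 3ᵏ·L` for every `k` — the cofactor format is strictly weaker than the wall unless squares + parity are used. -/

example : (35 : ℤ) ∣ (3 : ℤ) ^ 0 * 5 * 7 := by norm_num

example : IsSquarefreeUpTo (3 : ℤ) 7 := by
  intro x hx
  refine ⟨0, ?_⟩
  rw [pow_zero]
  have h7 : Squarefree (7 : ℤ) := by
    have hp : Prime (7 : ℤ) := Int.prime_iff_natAbs_prime.mpr (by norm_num)
    exact hp.irreducible.squarefree
  exact (h7 x hx).dvd

example : ¬ ∃ k : ℕ, (35 : ℤ) ∣ (3 : ℤ) ^ k * 5 := by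
  rintro ⟨k, hk⟩
  have hp : Prime (7 : ℤ) := Int.prime_iff_natAbs_prime.mpr (by norm_num)
  have h7 : (7 : ℤ) ∣ (3 : ℤ) ^ k * 5 := (Dvd.intro_left 5 (by norm_num) : (7 : ℤ) ∣ 35).trans hk
  rcases hp.dvd_or_dvd h7 with h | h
  · have h3 := hp.dvd_of_dvd_pow h
    norm_num at h3
  · norm_num at h

end Summit.BirchSwinnertonDyer.BirchSwinnertonDyer.Cruxes.RationalSplitIMCInclusionAtThree.SquarefreeCofactorParity

end
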